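import Literature.RingTheory.CohomologyAnnihilator.SyzygyDescent
import Literature.RingTheory.CohomologyAnnihilator.SyzygyBasic
import Literature.RingTheory.CohomologyAnnihilator.BirationalTransfer
import Mathlib.LinearAlgebra.FreeModule.Basic
import Mathlib.RingTheory.Ideal.Quotient.Basic
import HarnessLib

/-!
# The cohomology annihilator lies in the trace ideal of every non-zero ideal it stably annihilates

Topic: `Literature/RingTheory/CohomologyAnnihilator`.

For a commutative ring `R` and an `R`-module `M` the **trace ideal** of `M` is
`tr_R(M) = Σ_{φ ∈ M^*} φ(M)`; we do not introduce a definition and write it as the supremum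
`⨆ φ : Module.Dual R M, LinearMap.range φ` of ideals of `R`. Dey [Dey2022TraceIdeal, Thm. 1.1]
proves, for a finitely generated `R`-submodule `M ⊆ Q(R)` containing a non-zero-divisor,
`tr_R(M) = ⋂_{i>0, N} ann_R Extⁱ_R(M, N) = ann_R Ext¹_R(M, Ω M) = {x | x · id_M factors through a
finitely generated free module}` (the «stable annihilator» of Dao–Kobayashi–Takahashi / Esentepe).
We vendor the inclusion that upper-bounds cohomology annihilators, for non-zero ideals of a
domain (= rank-one torsion-free modules up to isomorphism):

* `mem_iSup_range_dual_of_comp_eq_smul` — if `c • id_I` factors `I → F → I` through a FREE module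
  then `c ∈ tr_R(I)` (pick `0 ≠ x ∈ I`; `c·x = Σᵢ φᵢ(x)·aᵢ = x·Σᵢ φᵢ(aᵢ)` with `φᵢ = coordᵢ ∘ f`,
  `aᵢ = g(bᵢ)`; cancel `x`); `…_of_projective` — the same through a projective module;
* `mem_iSup_range_dual_of_mem_cohomologyAnnihilatorOfDegree_of_isSyzygy` — over a noetherian
  domain, if `c ∈ caᵗ⁺¹(R)` (Iyengar–Takahashi) and the ideal `I ≠ 0` is a `(t+1)`-th syzygy
  module of a finitely generated module, then `c ∈ tr_R(I)` (stable factorisation on high syzygies,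
  `exists_comp_eq_smul_id_of_isSyzygy`, + the above);
* `cohomologyAnnihilatorOfDegree_one_le_iSup_range_dual` — `ca¹(R) ⊆ tr_R(I)` for every
  non-zero ideal (`I` is a first syzygy of `R ⧸ I`).

Use (route `ResolutionOfSingularities/HomologicalConductor`, kill test `SurfaceTermination`): for a
two-dimensional normal (Gorenstein) germ every divisorial ideal `I_D` is a high syzygy, so
`ca ⊆ ⋂_{D ≠ 0} I_D·I_D⁻¹` — the certified UPPER bound on `ca` used against non-rational germs
(positive-dimensional `Cl⁰`), complementing the Jacobian LOWER bound.

Not here: the reverse inclusion `tr(M) ⊆ sann(M)` of Dey's theorem, fractional (non-integral)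
ideals, higher rank (where only `rank · c ∈ tr(M)` holds).

## References
* S. Dey, *Trace ideal and annihilator of Ext and Tor of regular fractional ideals, and some
  applications*, arXiv:2210.03891 (2022), Thm. 1.1 (= Thm. 3.3). [`Dey2022TraceIdeal`]
* S. B. Iyengar, R. Takahashi, *Annihilation of cohomology and strong generation of module
  categories*, IMRN 2016, §2. [`IyengarTakahashi2014`]
-/

noncomputable section

open CategoryTheory CategoryTheory.Abelian

universe u v

namespace Literature.RingTheory.CohomologyAnnihilator

section Trace

variable {R : Type u} [CommRing R]

/-- **Stable factorisation through a free module forces membership in the trace ideal** (the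
rank-one case of [Dey2022TraceIdeal, Thm. 1.1], inclusion `{x · id factors through free} ⊆ tr`):
let `R` be a domain, `I ≠ 0` an ideal, `F` a free `R`-module and `f : I → F`, `g : F → I` linear
with `g (f x) = c • x` for all `x ∈ I`. Then `c ∈ tr_R(I) = ⨆_φ range φ` (`φ` over `I^* = Hom(I,R)`).
Proof: for `0 ≠ x ∈ I`, `c x = Σᵢ (coordᵢ f x) · g(bᵢ) = x · Σᵢ coordᵢ (f (g bᵢ))` since
`φ(x)·a = φ(a • x) = φ(x • a) = x·φ(a)` for `a ∈ I`; cancel `x`. [cite: Dey2022TraceIdeal, Thm. 1.1] -/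
theorem mem_iSup_range_dual_of_comp_eq_smul [IsDomain R] {I : Ideal R} (hI : I ≠ ⊥)
    {F : Type v} [AddCommGroup F] [Module R F] [Module.Free R F]
    (f : ↥I →ₗ[R] F) (g : F →ₗ[R] ↥I) {c : R} (h : ∀ x : ↥I, g (f x) = c • x) :
    c ∈ ⨆ φ : Module.Dual R ↥I, LinearMap.range φ := by
  classical
  obtain ⟨x, hxI, hx0⟩ := Submodule.exists_mem_ne_zero_of_ne_bot hI
  let b := Module.Free.chooseBasis R F
  set x' : ↥I := ⟨x, hxI⟩ with hx'
  let φ : Module.Free.ChooseBasisIndex R F → Module.Dual R ↥I := fun i => (b.coord i) ∘ₗ f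
  let a : Module.Free.ChooseBasisIndex R F → ↥I := fun i => g (b i)
  -- the key commutation `φᵢ(x) * aᵢ = x * φᵢ(aᵢ)`
  have key : ∀ i, (φ i x' : R) * (a i : R) = x * (φ i (a i) : R) := by
    intro i
    have h1 : (x : R) • a i = ((a i : ↥I) : R) • x' := by
      apply Subtype.ext
      simp [x', mul_comm]
    have h2 : φ i ((x : R) • a i) = x * φ i (a i) := by rw [map_smul, smul_eq_mul]
    rw [h1, map_smul, smul_eq_mul] at h2
    rw [mul_comm]
    exact h2
  -- expand `f x'` in the basis `b`
  set s := (b.repr (f x')).support with hs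
  have hfx : f x' = ∑ i ∈ s, (b.repr (f x')) i • b i := by
    conv_lhs => rw [← b.linearCombination_repr (f x')]
    rw [Finsupp.linearCombination_apply]
    rfl
  have H := h x'
  rw [hfx, map_sum] at H
  simp_rw [map_smul] at H
  -- pass to `R`
  have H' := congrArg (fun y : ↥I => (y : R)) H
  simp only [AddSubmonoidClass.coe_finsetSum, SetLike.val_smul, smul_eq_mul] at H'
  -- `H' : ∑ i ∈ s, (b.repr (f x')) i * ↑(g (b i)) = c * x`
  have H'' : c * x = x * ∑ i ∈ s, (φ i (a i) : R) := by
    rw [← H', Finset.mul_sum]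
    refine Finset.sum_congr rfl fun i _ => ?_
    have : (b.repr (f x')) i = φ i x' := by simp [φ, Module.Basis.coord_apply]
    rw [this]
    exact key i
  have hc : c = ∑ i ∈ s, (φ i (a i) : R) := by
    rw [mul_comm c x] at H''
    exact mul_left_cancel₀ hx0 H''
  rw [hc]
  exact Submodule.sum_mem _ fun i _ =>
    (le_iSup (fun ψ : Module.Dual R ↥I => LinearMap.range ψ) (φ i)) (LinearMap.mem_range_self _ _)

/-- The same through a PROJECTIVE module (a retract of the free module `P →₀ R`).
[cite: Dey2022TraceIdeal, Thm. 1.1] -/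
theorem mem_iSup_range_dual_of_comp_eq_smul_of_projective [IsDomain R] {I : Ideal R}
    (hI : I ≠ ⊥) {P : Type v} [AddCommGroup P] [Module R P] [Module.Projective R P]
    (f : ↥I →ₗ[R] P) (g : P →ₗ[R] ↥I) {c : R} (h : ∀ x : ↥I, g (f x) = c • x) :
    c ∈ ⨆ φ : Module.Dual R ↥I, LinearMap.range φ := by
  obtain ⟨s, hs⟩ := Module.projective_def.mp ‹Module.Projective R P›
  refine mem_iSup_range_dual_of_comp_eq_smul hI (s ∘ₗ f)
    (g ∘ₗ Finsupp.linearCombination R id) fun x => ?_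
  simp only [LinearMap.coe_comp, Function.comp_apply]
  rw [hs (f x), h x]

/-- **`caᵗ⁺¹(R) ⊆ tr_R(I)` for every non-zero ideal `I` that is a `(t+1)`-th syzygy** (over a
noetherian domain): if `c ∈ caᵗ⁺¹(R)` (Iyengar–Takahashi's cohomology annihilator of degree
`t+1`) and `IsSyzygy (t+1) X (ModuleCat.of R I)` for a finitely generated `X`, then `c • 𝟙_I`
factors through a finitely generated projective (`exists_comp_eq_smul_id_of_isSyzygy`), hence
`c ∈ ⨆_φ range φ`. [cite: Dey2022TraceIdeal, Thm. 1.1] -/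
theorem mem_iSup_range_dual_of_mem_cohomologyAnnihilatorOfDegree_of_isSyzygy [IsNoetherianRing R]
    [IsDomain R] {I : Ideal R} (hI : I ≠ ⊥) {t : ℕ} {c : R}
    (hc : c ∈ cohomologyAnnihilatorOfDegree R (t + 1)) {X : ModuleCat.{u} R} [Module.Finite R X]
    (hY : IsSyzygy (t + 1) X (ModuleCat.of R ↥I)) :
    c ∈ ⨆ φ : Module.Dual R ↥I, LinearMap.range φ := by
  obtain ⟨P, _, hP, ι, π, hιπ⟩ := exists_comp_eq_smul_id_of_isSyzygy hc hY
  haveI : Module.Projective R P := moduleProjective_of_projective P hP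
  have h' := (ModuleCat.comp_eq_smul_id_iff ι π c).mp hιπ
  exact mem_iSup_range_dual_of_comp_eq_smul_of_projective hI ι.hom π.hom fun x => by
    simpa using LinearMap.congr_fun h' x

/-- An ideal is a first syzygy module of its quotient ring: `0 → I → R → R ⧸ I → 0` with `R`
finitely generated free (private plumbing for the corollary below). [folklore] -/
private theorem isSyzygy_one_ideal (I : Ideal R) :
    IsSyzygy 1 (ModuleCat.of R (R ⧸ I)) (ModuleCat.of R ↥I) := by
  obtain ⟨w, hS⟩ := exists_shortExact_of_linearMap (Y := ModuleCat.of R ↥I) (M := ModuleCat.of R R)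
    (X := ModuleCat.of R (R ⧸ I)) I.subtype I.mkQ Subtype.val_injective (Submodule.mkQ_surjective I)
    (LinearMap.exact_subtype_mkQ I)
  exact isSyzygy_one_iff.mpr ⟨ModuleCat.of R R, inferInstance,
    (IsProjective.iff_projective (R := R) R).mp inferInstance, _, _, w, hS⟩

/-- **`ca¹(R) ⊆ tr_R(I)` for every non-zero ideal `I` of a noetherian domain** (the case `t = 0`
of `mem_iSup_range_dual_of_mem_cohomologyAnnihilatorOfDegree_of_isSyzygy` with `X = R ⧸ I`).
[cite: Dey2022TraceIdeal, Thm. 1.1] -/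
theorem cohomologyAnnihilatorOfDegree_one_le_iSup_range_dual [IsNoetherianRing R] [IsDomain R]
    {I : Ideal R} (hI : I ≠ ⊥) :
    cohomologyAnnihilatorOfDegree R 1 ≤ ⨆ φ : Module.Dual R ↥I, LinearMap.range φ := fun _ hc =>
  mem_iSup_range_dual_of_mem_cohomologyAnnihilatorOfDegree_of_isSyzygy hI (t := 0) hc
    (isSyzygy_one_ideal I)

end Trace

end Literature.RingTheory.CohomologyAnnihilator

end
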